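import Summits.CriticalPhenomena.PercolationContinuityZ3.Theorems.Transplant.Slab111HubW19
import HarnessLib

/-!
# The HUB ROUTING of the `(111)`-films, IX-b: the cleared set of the UNCLIPPED shape, corrected — `W18` (no corners on either boundary level)

builds on p205010 (kernel theorem, internal audit signed; external expert review pending) — NOT used in this file.  Lane `prim-bschramm`, seat
`prim-bschramm-p2` (gen 36; class C1b; memo `HOME/bschramm/P2-LATTICES.md` §130); helper file (`--supports stmt-CriticalPhenomena-4575 --as helper`).
For the blocks `(z, t_R, t_D, s_R, s_D)` of «HexShadowVRouteData».`ShapedLinkage 3` with `t_R ≥ 2` and `s_R ≥ 2` (no clipping inside radius `2`) the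
gen-36 instance chooses the cleared vertex set **`W18 k z`**: all film vertices over `hexBall z 2` except the SIX CORNERS of the hexagon at the two
boundary levels `0` and `k`.  («Slab111HubW18».`W18` removed only the degree-`1` corners; but a degree-`2` corner at a boundary level — e.g.
`z+(2,0)` at level `0`, whose only neighbours are `z+(2,−1), z+(1,1)` at level `1` — can be the exit `w'` of a certified terminal triple whose
`E₁, E₂` are exactly those two neighbours, and then NO swap pair exists (the branch to `w'` must start at `E₁` and `w'` would have to be the
successor of `E₁` on the other rerouted piece); removing all boundary corners removes these triples and creates no new enclosed vertex, memo §130.)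
* §1 relative columns `relC`, the 19 columns `hex2`, `W18`;
* §2 the two containments the node asks for (`W18_subset_blkR`, `mem_W18_of_hexBall_one`), `W18 = PR` for these blocks (`W18_subset_lift`);
* §3 what the dispatcher needs: columns of members are in `hex2` (`relC_mem_hex2`), BULK MEMBERSHIP (every vertex over `hex2` at a level in `[1, k−1]` is
  in `W18`: `vl_mem_W18`), and `sh x = vcol z (relC z x)`.
[cite: DuminilCopinSidoraviciusTassion2016, §2.3 (proof of Fact 2: the ball B_R(z))]
-/

noncomputable section

namespace Summit.CriticalPhenomena.PercolationContinuityZ3.Theorems.Transplant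

open Literature.Probability.Percolation Literature.Probability.LatticeModels SimpleGraph
open scoped Classical

namespace Slab111

variable {k : ℕ}

/-! ## §1 The set -/

/-- A corner of the radius-2 hexagon: `±(2,0), ±(0,2), ±(2,−2)` (Boolean test). [folklore] -/
def cornerB (p : ℤ × ℤ) : Bool := p == (-2, 0) || p == (0, 2) || p == (2, -2) || p == (2, 0) || p == (0, -2) || p == (-2, 2)

/-- `cornerB` spelled out. [folklore] -/
theorem cornerB_iff (p : ℤ × ℤ) : cornerB p = true ↔ p = (-2, 0) ∨ p = (0, 2) ∨ p = (2, -2) ∨ p = (2, 0) ∨ p = (0, -2) ∨ p = (-2, 2) := by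
  unfold cornerB; simp only [Bool.or_eq_true, beq_iff_eq, or_assoc]

/-- **The cleared set of the unclipped shape**: the lift of `hexBall z 2` minus the six corners at the boundary levels `0` and `k`.
[cite: DuminilCopinSidoraviciusTassion2016, §2.3 (proof of Fact 2: the ball B_R(z))] -/
def W18 (k : ℕ) (z : Site 2) : Set (slab111 k) :=
  {x | tnZ (relC z x) ≤ 2 ∧ ¬ ((lev (x : Site 3) = 0 ∨ lev (x : Site 3) = k) ∧ cornerB (relC z x) = true)}

/-! ## §2 The containments -/

/-- **`W18` lies over the cleared block** for every `t_D, s_D ≥ 2`. [folklore] -/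
theorem W18_subset_blkR (z : Site 2) {tD sD : ℕ} (ht : 2 ≤ tD) (hs : 2 ≤ sD) : ∀ x ∈ W18 k z, (hexShadow k).sh x ∈ blkR 3 z tD sD := by
  intro x hx
  have h2 := hx.1
  rw [tnZ_relC] at h2
  have h2' : triNorm (sh x - z) ≤ 2 := h2
  simp only [hexShadow_sh, mem_blkR, mem_hexBall]
  have habs := h2'
  simp only [triNorm, Pi.sub_apply, max_le_iff, abs_le] at habs
  refine ⟨by omega, by omega, by omega⟩

/-- **`W18` contains every vertex over `hexBall z 1`** (no corner is that close to the centre). [folklore] -/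
theorem mem_W18_of_hexBall_one (z : Site 2) (x : slab111 k) (h1 : (hexShadow k).sh x ∈ hexBall z 1) : x ∈ W18 k z := by
  simp only [hexShadow_sh, mem_hexBall] at h1
  have h1' : triNorm (sh x - z) ≤ 1 := by exact_mod_cast h1
  have habs := h1'
  simp only [triNorm, Pi.sub_apply, max_le_iff, abs_le] at habs
  refine ⟨by rw [tnZ_relC]; omega, ?_⟩
  rintro ⟨-, hc⟩
  rw [cornerB_iff] at hc
  rcases hc with hc | hc | hc | hc | hc | hc <;> simp only [relC, Prod.mk.injEq, Pi.sub_apply] at hc <;> omega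

/-- For `t_R, s_R ≥ 2` every vertex of `W18` lies over the rerouting block, so `W18 ∩ lift(blk_R) = W18`. [folklore] -/
theorem W18_subset_lift (z : Site 2) {tR sR : ℕ} (ht : 2 ≤ tR) (hs : 2 ≤ sR) : W18 k z ⊆ (hexShadow k).lift (blkR 3 z tR sR) := fun x hx => by
  rw [HexShadow.mem_lift]; exact W18_subset_blkR z ht hs x hx

/-! ## §3 Columns of members and bulk membership -/

/-- **The column of a member of `W18` is one of the 19.** [folklore] -/
theorem relC_mem_hex2' {z : Site 2} {x : slab111 k} (hx : x ∈ W18 k z) : relC z x ∈ hex2 := mem_hex2_of_tnZ hx.1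

/-- **BULK MEMBERSHIP**: every film vertex over a column of the hexagon at a level in `[1, k−1]` lies in `W18`. [folklore] -/
theorem vl_mem_W18 {z : Site 2} {c0 : ℤ} (hz : (3 : ℤ) ∣ z 0 + 2 * z 1 - c0) :
    ∀ q ∈ hex2, ∀ L : ℤ, 1 ≤ L → L ≤ (k : ℤ) - 1 → (3 : ℤ) ∣ L - c0 - (q.1 + 2 * q.2) → vl k (vcol z q) L ∈ W18 k z := by
  intro q hq L h1 hk hd
  have hadm := adm_vcol (k := k) hz (by omega) (by omega) hd
  refine ⟨?_, ?_⟩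
  · rw [relC_vl hadm]; exact tnZ_le_of_mem_hex2 q hq
  · rintro ⟨h0, -⟩; rw [lev_vl hadm] at h0; omega

/-- **The facts about a member of `W18` the dispatcher uses**: its relative column is in `hex2`, `sh x = vcol z (relC z x)`, and its level is in
`[0, k]`. [folklore] -/
theorem member_facts' {z : Site 2} {x : slab111 k} (hx : x ∈ W18 k z) :
    relC z x ∈ hex2 ∧ sh x = vcol z (relC z x) ∧ 0 ≤ lev (x : Site 3) ∧ lev (x : Site 3) ≤ k :=
  ⟨relC_mem_hex2' hx, sh_eq_vcol_relC z x, (mem_slab111_iff_lev.1 x.2).1, (mem_slab111_iff_lev.1 x.2).2⟩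

/-- **BOUNDARY MEMBERSHIP**: a film vertex over a NON-CORNER column of the hexagon at level `0` or `k` lies in `W18`. [folklore] -/
theorem vl_mem_W18_bdry {z : Site 2} {c0 : ℤ} (hz : (3 : ℤ) ∣ z 0 + 2 * z 1 - c0) {q : ℤ × ℤ} (hq : q ∈ hex2) (hc : cornerB q = false) {L : ℤ}
    (h0 : 0 ≤ L) (hk : L ≤ (k : ℤ)) (hd : (3 : ℤ) ∣ L - c0 - (q.1 + 2 * q.2)) : vl k (vcol z q) L ∈ W18 k z := by
  have hadm := adm_vcol (k := k) hz h0 hk hd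
  refine ⟨?_, ?_⟩
  · rw [relC_vl hadm]; exact tnZ_le_of_mem_hex2 q hq
  · rintro ⟨-, hc'⟩; rw [relC_vl hadm, hc] at hc'; exact Bool.false_ne_true hc'

end Slab111

end Summit.CriticalPhenomena.PercolationContinuityZ3.Theorems.Transplant

end
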